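import Mathlib
import Summits.NavierStokesRegularity.OSWSelfSimilar.TypeIIInnerLimitDichotomy
import Summits.NavierStokesRegularity.OSWSelfSimilar.TypeIIInnerLimitSwirlBoundLifespan
import HarnessLib
/-!
# Case A from zoom data: the axis-centred inner limit is axisymmetric with bounded swirl (zone Z1 TEMPLATE §T1.4-I
# (I-2)/(I-3)/(I-4), kernel)

HONEST FRAMING (cell ns-blowup GROUP B «PROFILE SEARCH», zone Z1; D-0035/D-0074): part XVIII of the Z1 dictionary. Part XVI
(`TypeIIInnerLimitDichotomy`) wrote the (I-4) dichotomy against the conjecture leaf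
`Summit.NavierStokesRegularity.NavierStokesRegularity.AxisymmetricLiouvilleBoundedSwirl` taking as HYPOTHESES, in Case A, that
the inner object is axisymmetric with bounded swirl. This file derives those two hypotheses from ZOOM DATA in the TEMPLATE's
own gauge (G1) (centre `x*(t)` ON the axis, so that Case A/B of (I-3) is the dichotomy «`r_m(τ) = d_n` bounded or not»):

* `isAxisymmetric_zoomSlice_of_axisCentre` — a slice `y ↦ λ • v(t, x* + λ • y)` of the zoom of an axisymmetric field about a
  centre `x*` ON the axis is axisymmetric (standard axis);
* `isAxisymmetric_ancientLimit_of_axisCentred` — hence every pointwise limit slice `W(s, ·)` of an axis-centred zoom of an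
  axisymmetric classical solution along `tₙ ↑ T⋆`, `λₙ → 0`, is axisymmetric (`isAxisymmetric_of_tendsto`, part XVI);
* `caseA_data_of_axisCentred_zoom` — **Case-A data from the zoom**: axisymmetric slices AND the swirl bound `‖Γ₀‖_∞`
  (part XII `exists_swirl_bound_ancientLimit_of_lifespan`), under K8's standing lifespan hypotheses;
* `innerLimit_apply_eq_of_axisCentred_zoom_under_axisymmetricLiouville` — **IF (AX-L) holds, the axis-centred inner object of
  an axisymmetric blow-up (a KNSS blow-up limit arising as such a pointwise zoom limit) is constant in space on every slice**;
* `innerLimit_apply_eq_of_zoom_under_axisymmetricLiouville` — **the (I-3)/(I-4) dichotomy from zoom data**: under (AX-L), an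
  inner object that is EITHER the pointwise limit of an axis-centred zoom (Case A) OR the locally uniform limit of a
  max-centred zoom along receding axes (Case B, part XV — no conjecture needed there) is constant: «a type-(β) inner object
  requires ¬(AX-L)» with every hypothesis on the inner object now read off the pre-limit solution and the zoom.

**Nothing here asserts that (AX-L) holds or fails, that a blow-up occurs, or that any zoom converges.** «violates: n/a —
dictionary»; bears_on LADDER-NS N5/Z1 → N1 linear core / N0⁻ ((I-2)/(I-3)/(I-4)). Author: ns-blowup-profile-eng-1 g7, 2026-08-27.
-/

open Real Filter Topology Set MeasureTheory Function
open Literature.Analysis.FluidPDE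

namespace Summit.NavierStokesRegularity.OSWSelfSimilar
namespace TypeIIModulationDictionary

section CaseA

/-- **A zoom slice about an axis point is axisymmetric**: if `V` is axisymmetric (standard axis) and `x*` lies ON the axis
(`x*₀ = x*₁ = 0`), then `y ↦ λ • V(x* + λ • y)` is axisymmetric — `R_θ` fixes `x*` and commutes with the dilation.
[new here — dictionary] -/
theorem isAxisymmetric_zoomSlice_of_axisCentre {V : EuclideanSpace ℝ (Fin 3) → EuclideanSpace ℝ (Fin 3)}
    (hV : IsAxisymmetric V) {xc : EuclideanSpace ℝ (Fin 3)} (hx0 : xc 0 = 0) (hx1 : xc 1 = 0) (lam : ℝ) :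
    IsAxisymmetric fun y => lam • V (xc + lam • y) := by
  intro θ y
  have hfix : rotZ θ xc = xc := by
    ext i
    fin_cases i <;> simp [rotZ_apply_zero, rotZ_apply_one, rotZ_apply_two, hx0, hx1]
  have harg : xc + lam • rotZ θ y = rotZ θ (xc + lam • y) := by
    have h := (rotZL θ).map_add xc (lam • y)
    rw [map_smul] at h
    simp only [rotZL_apply] at h
    rw [h, hfix]
  show lam • V (xc + lam • rotZ θ y) = rotZ θ (lam • V (xc + lam • y))
  rw [harg, hV θ, ← rotZL_apply, ← rotZL_apply, map_smul]

variable {T ν M : ℝ} {v : ℝ → EuclideanSpace ℝ (Fin 3) → EuclideanSpace ℝ (Fin 3)}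
  {q : ℝ → EuclideanSpace ℝ (Fin 3) → ℝ} {W : ℝ → EuclideanSpace ℝ (Fin 3) → EuclideanSpace ℝ (Fin 3)}

/-- **The axis-centred inner limit is axisymmetric.** Let `v` be axisymmetric on `[0, T⋆)`, `T⋆ > 0`; for a zoom along
`tₙ → T⋆`, `tₙ < T⋆`, `λₙ → 0`, centres `xₙ*` on the axis, and `s ≤ 0`, if the slices `y ↦ λₙ • v(tₙ + λₙ² s, xₙ* + λₙ • y)`
converge pointwise to `W s`, then `W s` is axisymmetric (eventually `tₙ + λₙ² s ∈ [0, T⋆)`, part XII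
`eventually_mem_Ico_of_tendsto_zoom`; closedness `isAxisymmetric_of_tendsto`, part XVI). [new here — dictionary] -/
theorem isAxisymmetric_ancientLimit_of_axisCentred (hT : 0 < T) (haxi : ∀ t ∈ Ico 0 T, IsAxisymmetric (v t))
    {tn lamn : ℕ → ℝ} {xcn : ℕ → EuclideanSpace ℝ (Fin 3)} (htT : Tendsto tn atTop (𝓝 T))
    (hlt : ∀ n, tn n < T) (hlam : Tendsto lamn atTop (𝓝 0)) (hxc : ∀ n, xcn n 0 = 0 ∧ xcn n 1 = 0)
    {s : ℝ} (hs : s ≤ 0)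
    (hlim : ∀ y, Tendsto (fun n => lamn n • v (tn n + lamn n ^ 2 * s) (xcn n + lamn n • y)) atTop (𝓝 (W s y))) :
    IsAxisymmetric (W s) := by
  refine isAxisymmetric_of_tendsto (V := fun n y => lamn n • v (tn n + lamn n ^ 2 * s) (xcn n + lamn n • y)) ?_ hlim
  filter_upwards [eventually_mem_Ico_of_tendsto_zoom hT htT hlt hlam hs] with n hn
  exact isAxisymmetric_zoomSlice_of_axisCentre (haxi _ hn) (hxc n).1 (hxc n).2 (lamn n)

/-- **Case-A data from the zoom (TEMPLATE (I-2)/(I-3), gauge (G1) with the centre on the axis).** Under K8's standing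
lifespan hypotheses (classical unforced NS on `[0, T⋆)`, `ν > 0`, axisymmetric, bounded on every closed sub-slab,
`|Γ₀| ≤ M`), every pointwise limit `W` of an axis-centred zoom along `tₙ ↑ T⋆`, `λₙ → 0` has, for all `s < 0`,
AXISYMMETRIC slices and swirl bounded by `M = ‖Γ₀‖_∞` (part XII) — the two hypotheses of
`AxisymmetricLiouvilleBoundedSwirl` beyond the solution class. [new here — dictionary] -/
theorem caseA_data_of_axisCentred_zoom (hν : 0 < ν) (hT : 0 < T)
    (hcl : IsClassicalNSSolutionOn (Ico 0 T) ν 0 v q) (haxi : ∀ t ∈ Ico 0 T, IsAxisymmetric (v t))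
    (hbdd : ∀ T' < T, ∃ V₀ : ℝ, ∀ t ∈ Icc 0 T', ∀ x, ‖v t x‖ ≤ V₀) (hM : ∀ x, |swirl (v 0) x| ≤ M)
    {tn lamn : ℕ → ℝ} {xcn : ℕ → EuclideanSpace ℝ (Fin 3)} (htT : Tendsto tn atTop (𝓝 T))
    (hlt : ∀ n, tn n < T) (hlam : Tendsto lamn atTop (𝓝 0)) (hxc : ∀ n, xcn n 0 = 0 ∧ xcn n 1 = 0)
    (hlim : ∀ s < 0, ∀ y,
      Tendsto (fun n => lamn n • v (tn n + lamn n ^ 2 * s) (xcn n + lamn n • y)) atTop (𝓝 (W s y))) :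
    (∀ s < 0, IsAxisymmetric (W s)) ∧ ∃ C : ℝ, ∀ s < 0, ∀ y, |swirl (W s) y| ≤ C :=
  ⟨fun s hs => isAxisymmetric_ancientLimit_of_axisCentred hT haxi htT hlt hlam hxc hs.le (hlim s hs),
    exists_swirl_bound_ancientLimit_of_lifespan hν hT hcl haxi hbdd hM htT hlt hlam hxc hlim⟩

/-- **IF (AX-L) holds, the axis-centred inner object of an axisymmetric blow-up is constant in space.** Under the
hypotheses of `caseA_data_of_axisCentred_zoom`, if the pointwise zoom limit `W` is moreover a KNSS blow-up limit
(`IsKNSSBlowupLimit`: smooth bounded ancient mild, `|W| ≤ 1 = sup` — the (I-2) inner object) and the conjecture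
`Summit.NavierStokesRegularity.NavierStokesRegularity.AxisymmetricLiouvilleBoundedSwirl` holds, then `W(s, y) = W(s, 0)`
for all `s < 0` (part XVI `innerLimit_apply_eq_of_axisymmetricLiouville`). [new here — dictionary] -/
theorem innerLimit_apply_eq_of_axisCentred_zoom_under_axisymmetricLiouville
    (hAXL : Summit.NavierStokesRegularity.NavierStokesRegularity.AxisymmetricLiouvilleBoundedSwirl)
    (hν : 0 < ν) (hT : 0 < T)
    (hcl : IsClassicalNSSolutionOn (Ico 0 T) ν 0 v q) (haxi : ∀ t ∈ Ico 0 T, IsAxisymmetric (v t))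
    (hbdd : ∀ T' < T, ∃ V₀ : ℝ, ∀ t ∈ Icc 0 T', ∀ x, ‖v t x‖ ≤ V₀) (hM : ∀ x, |swirl (v 0) x| ≤ M)
    {tn lamn : ℕ → ℝ} {xcn : ℕ → EuclideanSpace ℝ (Fin 3)} (htT : Tendsto tn atTop (𝓝 T))
    (hlt : ∀ n, tn n < T) (hlam : Tendsto lamn atTop (𝓝 0)) (hxc : ∀ n, xcn n 0 = 0 ∧ xcn n 1 = 0)
    (hlim : ∀ s < 0, ∀ y,
      Tendsto (fun n => lamn n • v (tn n + lamn n ^ 2 * s) (xcn n + lamn n • y)) atTop (𝓝 (W s y)))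
    (hW : IsKNSSBlowupLimit W) :
    ∀ s < 0, ∀ y : EuclideanSpace ℝ (Fin 3), W s y = W s 0 := by
  obtain ⟨hax, hsw⟩ := caseA_data_of_axisCentred_zoom hν hT hcl haxi hbdd hM htT hlt hlam hxc hlim
  exact innerLimit_apply_eq_of_axisymmetricLiouville hAXL hW hax hsw

/-- **The (I-3)/(I-4) dichotomy from zoom data.** IF (AX-L) holds, then a KNSS blow-up limit `W` which is EITHER
(Case A) the pointwise slice-wise limit of an axis-centred zoom of an axisymmetric classical solution under K8's standing
lifespan hypotheses, OR (Case B) the locally uniform slice-wise limit of a zoom whose slices are axisymmetric about vertical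
axes receding to infinity (`−M_k e₀`, `M_k → ∞`; part XV, where NO conjecture is needed), is constant in space on every
slice. Equivalently: a type-(β) inner object of the TEMPLATE exists only if (AX-L) FAILS — with the Case-A hypotheses now
read off the pre-limit solution and the zoom. [new here — dictionary] -/
theorem innerLimit_apply_eq_of_zoom_under_axisymmetricLiouville
    (hAXL : Summit.NavierStokesRegularity.NavierStokesRegularity.AxisymmetricLiouvilleBoundedSwirl)
    (hW : IsKNSSBlowupLimit W)
    (hcase :
      (0 < ν ∧ 0 < T ∧ IsClassicalNSSolutionOn (Ico 0 T) ν 0 v q ∧ (∀ t ∈ Ico 0 T, IsAxisymmetric (v t)) ∧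
        (∀ T' < T, ∃ V₀ : ℝ, ∀ t ∈ Icc 0 T', ∀ x, ‖v t x‖ ≤ V₀) ∧ (∀ x, |swirl (v 0) x| ≤ M) ∧
        ∃ (tn lamn : ℕ → ℝ) (xcn : ℕ → EuclideanSpace ℝ (Fin 3)),
          Tendsto tn atTop (𝓝 T) ∧ (∀ n, tn n < T) ∧ Tendsto lamn atTop (𝓝 0) ∧
          (∀ n, xcn n 0 = 0 ∧ xcn n 1 = 0) ∧
          ∀ s < 0, ∀ y, Tendsto (fun n => lamn n • v (tn n + lamn n ^ 2 * s) (xcn n + lamn n • y)) atTop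
            (𝓝 (W s y))) ∨
      ∃ (Mk : ℕ → ℝ) (V : ℕ → ℝ → EuclideanSpace ℝ (Fin 3) → EuclideanSpace ℝ (Fin 3)),
        Tendsto Mk atTop atTop ∧
        (∀ k, ∀ s < 0, ∀ (θ : ℝ) (y : EuclideanSpace ℝ (Fin 3)),
          V k s (EuclideanSpace.single 0 (-Mk k) + rotZ θ (y - EuclideanSpace.single 0 (-Mk k))) = rotZ θ (V k s y)) ∧
        ∀ s < 0, TendstoLocallyUniformly (fun k => V k s) (W s) atTop) :
    ∀ s < 0, ∀ y : EuclideanSpace ℝ (Fin 3), W s y = W s 0 := by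
  rcases hcase with ⟨hν, hT, hcl, haxi, hbdd, hM, tn, lamn, xcn, htT, hlt, hlam, hxc, hlim⟩ | hB
  · exact innerLimit_apply_eq_of_axisCentred_zoom_under_axisymmetricLiouville hAXL hν hT hcl haxi hbdd hM htT hlt
      hlam hxc hlim hW
  · exact innerLimit_apply_eq_under_axisymmetricLiouville hAXL hW (Or.inr hB)

end CaseA

end TypeIIModulationDictionary
end Summit.NavierStokesRegularity.OSWSelfSimilar
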